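import Summits.Ventures.CertifiedManyBodySolver.Downfold.EmeryAxialSlabHg1212SubsA
import Summits.Ventures.CertifiedManyBodySolver.Downfold.EmeryAxialSlabHg1212SubsB
import Summits.Ventures.CertifiedManyBodySolver.Downfold.EmeryFermiFillingLa214
import HarnessLib

/-!
# HgBa₂CaCu₂O₆₊δ (box #257 Hg-1212, (K) source rows): HOW MUCH AXIAL (Cu-4s / apical) ADMIXTURE DOES THE BOX'S ONE-BAND FERMI SURFACE REQUIRE? — the certified
# co-shift census of the typed 3BE one-body box `emeryBoxHg1212K26Src` against its object-E row `t′/t ∈ [-0.524, -0.423]`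

Venture CertifiedManyBodySolver, cell `pub/hubbard-downfold` (stage S1, HUMAN RULINGS D-0096/D-0098: the 3 → 1 reduction error is carried explicitly),
seat hubbard-downfold-mod-4 (technique B = band level); namespace `Summit.Ventures.CertifiedManyBodySolver.Downfold.Emery`. Everything PROVED; numerics
decided by the kernel in `EmeryAxialSlabHg1212SubsA`, `EmeryAxialSlabHg1212SubsB`.

CONTEXT. `EmeryFermiFillingHg1212…` certified the σ three-band (d–p_x–p_y + t_pp, t_pp′) Fermi-surface `t′/t` window of this box at its own
hole count and compared it with the box's object-E row (router/BOXES/HgBa2CaCu2O6.md l.21 «tp/t (E) [−0.524, −0.423]»). `EmeryAxialFermiSurfaceShape` +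
`EmeryAxialConductionBand` (TRANSFER THEOREM `condBand_le_iff`, no separation hypothesis) prove that the four-orbital model of [AndersenEtAl1995] /
[PavariniEtAl2001] — Cu-4s (and through it the apical orbitals) added to the σ model — has, AT ITS FERMI LEVEL, exactly the conduction-band occupied
set, filling and Fermi surface of the σ model with CO-SHIFTED O–O hoppings `(t_pp + a, t_pp′ + a)`, ONE scalar `a = a_F = t_sp²/(ε_s − ε_F) ≥ 0`.
So «how much axial channel does the one-band FS of record require beyond the box's σ rows?» is a one-parameter question, answered here slab by slab
(sub-box rule version B, `EmeryFermiFillingSubBoxB`; edges 0, 0.15, 0.3, 0.35, 0.4, 0.45, 0.5, 0.6 eV; Δ_pd × t_pd split 2 × 2):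

| slab | a (eV) | ε_F window (eV above ε_d) | certified t′/t window | vs E row [-0.524, -0.423] |
|---|---|---|---|---|
| 0 | [0, 0.15] | [1.1, 1.94] | [-0.3717, -0.2682] | SHORT |
| 1 | [0.15, 0.3] | [1.04, 1.84] | [-0.4192, -0.322] | SHORT |
| 2 | [0.3, 0.35] | [1.04, 1.72] | [-0.4273, -0.3629] | MEETS |
| 3 | [0.35, 0.4] | [1.04, 1.7] | [-0.439, -0.3737] | MEETS |
| 4 | [0.4, 0.45] | [1.02, 1.68] | [-0.4496, -0.3843] | MEETS |
| 5 | [0.45, 0.5] | [1.02, 1.68] | [-0.4606, -0.3934] | MEETS |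
| 6 | [0.5, 0.6] | [0.98, 1.7] | [-0.4807, -0.4007] | MEETS |

READING (certified, numbers not adjectives): `a ∈ [0, 0.3]` ⇒ the co-shifted Fermi surface is STILL LESS cuprate-like than the E row (`t′/t > -0.423`): the REQUIRED axial admixture at the Fermi level is `a_F > 0.3` eV (`emeryBoxHg1212K26Src_axial_short`). The four-orbital form of the exclusion(s) is `emeryBoxHg1212K26Src_fourOrbital_short`:
for ANY axial level `ε_s` and coupling `t_sp`, a four-orbital completion of a box point whose conduction band holds the box's electrons at a Fermi level `ε_F < ε_s`
with `t_sp²/(ε_s − ε_F)` in the excluded range does NOT reproduce the E row. (Pavarini's range parameter for the PURE four-orbital model is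
`r = ½/(1 + s)`, `s = (ε_s − ε_F)(ε_F − ε_p)/(2t_sp)² = (ε_F + Δ_pd)/(4·a_total)`, where `a_total` would be the WHOLE O–O co-shift; the box's `t_pp, t_pp′` rows
already contain part of the axial channel when they come from a three-band Wannier fit, so `a_F` here is the ADDITIONAL admixture — a model-form
distance, not a material constant.)

WHAT THIS IS NOT: not a statement that the material's parameters ARE in the box (SCREENING-GRADE provenance); `U = 0` band kinematics; no phase
sentence; the E row is a [float] literature refit. Sources: [AndersenEtAl1995, §§5–6]; [PavariniEtAl2001, Eqs. (1)–(3), Fig. 3];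
[HybertsenSchluterChristensen1989, Eq. (1)].
-/

noncomputable section

namespace Summit.Ventures.CertifiedManyBodySolver.Downfold.Emery

open Real Set
open Summit.Ventures.CertifiedManyBodySolver.Downfold

/-! ## §1 Slab windows (raw co-shifted coordinates `t_pp′ := t_pp + a`, `c′ := t_pp′ + a`) -/

/-- **Slab 0, a ∈ [0, 0.15] eV**: on the co-shifted box (t_pp + a ∈ [0.644, 0.813], t_pp′ + a ∈ [0.163, 0.337]) at per-spin
filling ∈ [0.4, 0.42]: `ε_F ∈ [1.1, 1.94]` and `t′/t ∈ [-0.3717, -0.2682]` — SHORT vs the E row. [folklore] -/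
theorem hg1212AxSlab0_window {Δ tpd tpp c ε : ℝ} (hΔ : Δ ∈ Set.Icc (37 / 20 : ℝ) (49 / 20 : ℝ))
    (ha : tpd ∈ Set.Icc (241 / 200 : ℝ) (32 / 25 : ℝ)) (hb : tpp ∈ Set.Icc (161 / 250 : ℝ) (813 / 1000 : ℝ))
    (hc : c ∈ Set.Icc (163 / 1000 : ℝ) (337 / 1000 : ℝ))
    (hν : abFilling Δ tpd tpp c ε ∈ Set.Icc (2 / 5 : ℝ) (21 / 50 : ℝ)) :
    ε ∈ Set.Icc (11 / 10 : ℝ) (97 / 50 : ℝ) ∧ fsRatio Δ tpd tpp c ε ∈ Set.Icc (-(3717 / 10000 : ℝ)) (-(1341 / 5000 : ℝ)) := by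
  have hΔ' := hΔ
  constructor
  · clear hΔ
    rcases mem_Icc_split hΔ' (43 / 20 : ℝ) with hΔ' | hΔ'
    · rcases mem_Icc_split ha (497 / 400 : ℝ) with ha' | ha'
      · have h := (hg1212Ax0Sub_0_0 hΔ' ha' hb hc hν).1
        exact ⟨le_trans (by norm_num) h.1, h.2.trans (by norm_num)⟩
      · have h := (hg1212Ax0Sub_0_1 hΔ' ha' hb hc hν).1
        exact ⟨le_trans (by norm_num) h.1, h.2.trans (by norm_num)⟩
    · rcases mem_Icc_split ha (497 / 400 : ℝ) with ha' | ha'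
      · have h := (hg1212Ax0Sub_1_0 hΔ' ha' hb hc hν).1
        exact ⟨le_trans (by norm_num) h.1, h.2.trans (by norm_num)⟩
      · have h := (hg1212Ax0Sub_1_1 hΔ' ha' hb hc hν).1
        exact ⟨le_trans (by norm_num) h.1, h.2.trans (by norm_num)⟩
  · clear hΔ
    rcases mem_Icc_split hΔ' (43 / 20 : ℝ) with hΔ' | hΔ'
    · rcases mem_Icc_split ha (497 / 400 : ℝ) with ha' | ha'
      · have h := (hg1212Ax0Sub_0_0 hΔ' ha' hb hc hν).2
        exact ⟨le_trans (by norm_num) h.1, h.2.trans (by norm_num)⟩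
      · have h := (hg1212Ax0Sub_0_1 hΔ' ha' hb hc hν).2
        exact ⟨le_trans (by norm_num) h.1, h.2.trans (by norm_num)⟩
    · rcases mem_Icc_split ha (497 / 400 : ℝ) with ha' | ha'
      · have h := (hg1212Ax0Sub_1_0 hΔ' ha' hb hc hν).2
        exact ⟨le_trans (by norm_num) h.1, h.2.trans (by norm_num)⟩
      · have h := (hg1212Ax0Sub_1_1 hΔ' ha' hb hc hν).2
        exact ⟨le_trans (by norm_num) h.1, h.2.trans (by norm_num)⟩

/-- **Slab 1, a ∈ [0.15, 0.3] eV**: on the co-shifted box (t_pp + a ∈ [0.794, 0.963], t_pp′ + a ∈ [0.313, 0.487]) at per-spin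
filling ∈ [0.4, 0.42]: `ε_F ∈ [1.04, 1.84]` and `t′/t ∈ [-0.4192, -0.322]` — SHORT vs the E row. [folklore] -/
theorem hg1212AxSlab1_window {Δ tpd tpp c ε : ℝ} (hΔ : Δ ∈ Set.Icc (37 / 20 : ℝ) (49 / 20 : ℝ))
    (ha : tpd ∈ Set.Icc (241 / 200 : ℝ) (32 / 25 : ℝ)) (hb : tpp ∈ Set.Icc (397 / 500 : ℝ) (963 / 1000 : ℝ))
    (hc : c ∈ Set.Icc (313 / 1000 : ℝ) (487 / 1000 : ℝ))
    (hν : abFilling Δ tpd tpp c ε ∈ Set.Icc (2 / 5 : ℝ) (21 / 50 : ℝ)) :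
    ε ∈ Set.Icc (26 / 25 : ℝ) (46 / 25 : ℝ) ∧ fsRatio Δ tpd tpp c ε ∈ Set.Icc (-(262 / 625 : ℝ)) (-(161 / 500 : ℝ)) := by
  have hΔ' := hΔ
  constructor
  · clear hΔ
    rcases mem_Icc_split hΔ' (43 / 20 : ℝ) with hΔ' | hΔ'
    · rcases mem_Icc_split ha (497 / 400 : ℝ) with ha' | ha'
      · have h := (hg1212Ax1Sub_0_0 hΔ' ha' hb hc hν).1
        exact ⟨le_trans (by norm_num) h.1, h.2.trans (by norm_num)⟩
      · have h := (hg1212Ax1Sub_0_1 hΔ' ha' hb hc hν).1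
        exact ⟨le_trans (by norm_num) h.1, h.2.trans (by norm_num)⟩
    · rcases mem_Icc_split ha (497 / 400 : ℝ) with ha' | ha'
      · have h := (hg1212Ax1Sub_1_0 hΔ' ha' hb hc hν).1
        exact ⟨le_trans (by norm_num) h.1, h.2.trans (by norm_num)⟩
      · have h := (hg1212Ax1Sub_1_1 hΔ' ha' hb hc hν).1
        exact ⟨le_trans (by norm_num) h.1, h.2.trans (by norm_num)⟩
  · clear hΔ
    rcases mem_Icc_split hΔ' (43 / 20 : ℝ) with hΔ' | hΔ'
    · rcases mem_Icc_split ha (497 / 400 : ℝ) with ha' | ha'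
      · have h := (hg1212Ax1Sub_0_0 hΔ' ha' hb hc hν).2
        exact ⟨le_trans (by norm_num) h.1, h.2.trans (by norm_num)⟩
      · have h := (hg1212Ax1Sub_0_1 hΔ' ha' hb hc hν).2
        exact ⟨le_trans (by norm_num) h.1, h.2.trans (by norm_num)⟩
    · rcases mem_Icc_split ha (497 / 400 : ℝ) with ha' | ha'
      · have h := (hg1212Ax1Sub_1_0 hΔ' ha' hb hc hν).2
        exact ⟨le_trans (by norm_num) h.1, h.2.trans (by norm_num)⟩
      · have h := (hg1212Ax1Sub_1_1 hΔ' ha' hb hc hν).2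
        exact ⟨le_trans (by norm_num) h.1, h.2.trans (by norm_num)⟩

/-- **Slab 2, a ∈ [0.3, 0.35] eV**: on the co-shifted box (t_pp + a ∈ [0.944, 1.013], t_pp′ + a ∈ [0.463, 0.537]) at per-spin
filling ∈ [0.4, 0.42]: `ε_F ∈ [1.04, 1.72]` and `t′/t ∈ [-0.4273, -0.3629]` — MEETS vs the E row. [folklore] -/
theorem hg1212AxSlab2_window {Δ tpd tpp c ε : ℝ} (hΔ : Δ ∈ Set.Icc (37 / 20 : ℝ) (49 / 20 : ℝ))
    (ha : tpd ∈ Set.Icc (241 / 200 : ℝ) (32 / 25 : ℝ)) (hb : tpp ∈ Set.Icc (118 / 125 : ℝ) (1013 / 1000 : ℝ))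
    (hc : c ∈ Set.Icc (463 / 1000 : ℝ) (537 / 1000 : ℝ))
    (hν : abFilling Δ tpd tpp c ε ∈ Set.Icc (2 / 5 : ℝ) (21 / 50 : ℝ)) :
    ε ∈ Set.Icc (26 / 25 : ℝ) (43 / 25 : ℝ) ∧ fsRatio Δ tpd tpp c ε ∈ Set.Icc (-(4273 / 10000 : ℝ)) (-(3629 / 10000 : ℝ)) := by
  have hΔ' := hΔ
  constructor
  · clear hΔ
    rcases mem_Icc_split hΔ' (43 / 20 : ℝ) with hΔ' | hΔ'
    · rcases mem_Icc_split ha (497 / 400 : ℝ) with ha' | ha'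
      · have h := (hg1212Ax2Sub_0_0 hΔ' ha' hb hc hν).1
        exact ⟨le_trans (by norm_num) h.1, h.2.trans (by norm_num)⟩
      · have h := (hg1212Ax2Sub_0_1 hΔ' ha' hb hc hν).1
        exact ⟨le_trans (by norm_num) h.1, h.2.trans (by norm_num)⟩
    · rcases mem_Icc_split ha (497 / 400 : ℝ) with ha' | ha'
      · have h := (hg1212Ax2Sub_1_0 hΔ' ha' hb hc hν).1
        exact ⟨le_trans (by norm_num) h.1, h.2.trans (by norm_num)⟩
      · have h := (hg1212Ax2Sub_1_1 hΔ' ha' hb hc hν).1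
        exact ⟨le_trans (by norm_num) h.1, h.2.trans (by norm_num)⟩
  · clear hΔ
    rcases mem_Icc_split hΔ' (43 / 20 : ℝ) with hΔ' | hΔ'
    · rcases mem_Icc_split ha (497 / 400 : ℝ) with ha' | ha'
      · have h := (hg1212Ax2Sub_0_0 hΔ' ha' hb hc hν).2
        exact ⟨le_trans (by norm_num) h.1, h.2.trans (by norm_num)⟩
      · have h := (hg1212Ax2Sub_0_1 hΔ' ha' hb hc hν).2
        exact ⟨le_trans (by norm_num) h.1, h.2.trans (by norm_num)⟩
    · rcases mem_Icc_split ha (497 / 400 : ℝ) with ha' | ha'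
      · have h := (hg1212Ax2Sub_1_0 hΔ' ha' hb hc hν).2
        exact ⟨le_trans (by norm_num) h.1, h.2.trans (by norm_num)⟩
      · have h := (hg1212Ax2Sub_1_1 hΔ' ha' hb hc hν).2
        exact ⟨le_trans (by norm_num) h.1, h.2.trans (by norm_num)⟩

/-- **Slab 3, a ∈ [0.35, 0.4] eV**: on the co-shifted box (t_pp + a ∈ [0.994, 1.063], t_pp′ + a ∈ [0.513, 0.587]) at per-spin
filling ∈ [0.4, 0.42]: `ε_F ∈ [1.04, 1.7]` and `t′/t ∈ [-0.439, -0.3737]` — MEETS vs the E row. [folklore] -/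
theorem hg1212AxSlab3_window {Δ tpd tpp c ε : ℝ} (hΔ : Δ ∈ Set.Icc (37 / 20 : ℝ) (49 / 20 : ℝ))
    (ha : tpd ∈ Set.Icc (241 / 200 : ℝ) (32 / 25 : ℝ)) (hb : tpp ∈ Set.Icc (497 / 500 : ℝ) (1063 / 1000 : ℝ))
    (hc : c ∈ Set.Icc (513 / 1000 : ℝ) (587 / 1000 : ℝ))
    (hν : abFilling Δ tpd tpp c ε ∈ Set.Icc (2 / 5 : ℝ) (21 / 50 : ℝ)) :
    ε ∈ Set.Icc (26 / 25 : ℝ) (17 / 10 : ℝ) ∧ fsRatio Δ tpd tpp c ε ∈ Set.Icc (-(439 / 1000 : ℝ)) (-(3737 / 10000 : ℝ)) := by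
  have hΔ' := hΔ
  constructor
  · clear hΔ
    rcases mem_Icc_split hΔ' (43 / 20 : ℝ) with hΔ' | hΔ'
    · rcases mem_Icc_split ha (497 / 400 : ℝ) with ha' | ha'
      · have h := (hg1212Ax3Sub_0_0 hΔ' ha' hb hc hν).1
        exact ⟨le_trans (by norm_num) h.1, h.2.trans (by norm_num)⟩
      · have h := (hg1212Ax3Sub_0_1 hΔ' ha' hb hc hν).1
        exact ⟨le_trans (by norm_num) h.1, h.2.trans (by norm_num)⟩
    · rcases mem_Icc_split ha (497 / 400 : ℝ) with ha' | ha'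
      · have h := (hg1212Ax3Sub_1_0 hΔ' ha' hb hc hν).1
        exact ⟨le_trans (by norm_num) h.1, h.2.trans (by norm_num)⟩
      · have h := (hg1212Ax3Sub_1_1 hΔ' ha' hb hc hν).1
        exact ⟨le_trans (by norm_num) h.1, h.2.trans (by norm_num)⟩
  · clear hΔ
    rcases mem_Icc_split hΔ' (43 / 20 : ℝ) with hΔ' | hΔ'
    · rcases mem_Icc_split ha (497 / 400 : ℝ) with ha' | ha'
      · have h := (hg1212Ax3Sub_0_0 hΔ' ha' hb hc hν).2
        exact ⟨le_trans (by norm_num) h.1, h.2.trans (by norm_num)⟩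
      · have h := (hg1212Ax3Sub_0_1 hΔ' ha' hb hc hν).2
        exact ⟨le_trans (by norm_num) h.1, h.2.trans (by norm_num)⟩
    · rcases mem_Icc_split ha (497 / 400 : ℝ) with ha' | ha'
      · have h := (hg1212Ax3Sub_1_0 hΔ' ha' hb hc hν).2
        exact ⟨le_trans (by norm_num) h.1, h.2.trans (by norm_num)⟩
      · have h := (hg1212Ax3Sub_1_1 hΔ' ha' hb hc hν).2
        exact ⟨le_trans (by norm_num) h.1, h.2.trans (by norm_num)⟩

/-- **Slab 4, a ∈ [0.4, 0.45] eV**: on the co-shifted box (t_pp + a ∈ [1.044, 1.113], t_pp′ + a ∈ [0.563, 0.637]) at per-spin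
filling ∈ [0.4, 0.42]: `ε_F ∈ [1.02, 1.68]` and `t′/t ∈ [-0.4496, -0.3843]` — MEETS vs the E row. [folklore] -/
theorem hg1212AxSlab4_window {Δ tpd tpp c ε : ℝ} (hΔ : Δ ∈ Set.Icc (37 / 20 : ℝ) (49 / 20 : ℝ))
    (ha : tpd ∈ Set.Icc (241 / 200 : ℝ) (32 / 25 : ℝ)) (hb : tpp ∈ Set.Icc (261 / 250 : ℝ) (1113 / 1000 : ℝ))
    (hc : c ∈ Set.Icc (563 / 1000 : ℝ) (637 / 1000 : ℝ))
    (hν : abFilling Δ tpd tpp c ε ∈ Set.Icc (2 / 5 : ℝ) (21 / 50 : ℝ)) :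
    ε ∈ Set.Icc (51 / 50 : ℝ) (42 / 25 : ℝ) ∧ fsRatio Δ tpd tpp c ε ∈ Set.Icc (-(281 / 625 : ℝ)) (-(3843 / 10000 : ℝ)) := by
  have hΔ' := hΔ
  constructor
  · clear hΔ
    rcases mem_Icc_split hΔ' (43 / 20 : ℝ) with hΔ' | hΔ'
    · rcases mem_Icc_split ha (497 / 400 : ℝ) with ha' | ha'
      · have h := (hg1212Ax4Sub_0_0 hΔ' ha' hb hc hν).1
        exact ⟨le_trans (by norm_num) h.1, h.2.trans (by norm_num)⟩
      · have h := (hg1212Ax4Sub_0_1 hΔ' ha' hb hc hν).1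
        exact ⟨le_trans (by norm_num) h.1, h.2.trans (by norm_num)⟩
    · rcases mem_Icc_split ha (497 / 400 : ℝ) with ha' | ha'
      · have h := (hg1212Ax4Sub_1_0 hΔ' ha' hb hc hν).1
        exact ⟨le_trans (by norm_num) h.1, h.2.trans (by norm_num)⟩
      · have h := (hg1212Ax4Sub_1_1 hΔ' ha' hb hc hν).1
        exact ⟨le_trans (by norm_num) h.1, h.2.trans (by norm_num)⟩
  · clear hΔ
    rcases mem_Icc_split hΔ' (43 / 20 : ℝ) with hΔ' | hΔ'
    · rcases mem_Icc_split ha (497 / 400 : ℝ) with ha' | ha'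
      · have h := (hg1212Ax4Sub_0_0 hΔ' ha' hb hc hν).2
        exact ⟨le_trans (by norm_num) h.1, h.2.trans (by norm_num)⟩
      · have h := (hg1212Ax4Sub_0_1 hΔ' ha' hb hc hν).2
        exact ⟨le_trans (by norm_num) h.1, h.2.trans (by norm_num)⟩
    · rcases mem_Icc_split ha (497 / 400 : ℝ) with ha' | ha'
      · have h := (hg1212Ax4Sub_1_0 hΔ' ha' hb hc hν).2
        exact ⟨le_trans (by norm_num) h.1, h.2.trans (by norm_num)⟩
      · have h := (hg1212Ax4Sub_1_1 hΔ' ha' hb hc hν).2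
        exact ⟨le_trans (by norm_num) h.1, h.2.trans (by norm_num)⟩

/-- **Slab 5, a ∈ [0.45, 0.5] eV**: on the co-shifted box (t_pp + a ∈ [1.094, 1.163], t_pp′ + a ∈ [0.613, 0.687]) at per-spin
filling ∈ [0.4, 0.42]: `ε_F ∈ [1.02, 1.68]` and `t′/t ∈ [-0.4606, -0.3934]` — MEETS vs the E row. [folklore] -/
theorem hg1212AxSlab5_window {Δ tpd tpp c ε : ℝ} (hΔ : Δ ∈ Set.Icc (37 / 20 : ℝ) (49 / 20 : ℝ))
    (ha : tpd ∈ Set.Icc (241 / 200 : ℝ) (32 / 25 : ℝ)) (hb : tpp ∈ Set.Icc (547 / 500 : ℝ) (1163 / 1000 : ℝ))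
    (hc : c ∈ Set.Icc (613 / 1000 : ℝ) (687 / 1000 : ℝ))
    (hν : abFilling Δ tpd tpp c ε ∈ Set.Icc (2 / 5 : ℝ) (21 / 50 : ℝ)) :
    ε ∈ Set.Icc (51 / 50 : ℝ) (42 / 25 : ℝ) ∧ fsRatio Δ tpd tpp c ε ∈ Set.Icc (-(2303 / 5000 : ℝ)) (-(1967 / 5000 : ℝ)) := by
  have hΔ' := hΔ
  constructor
  · clear hΔ
    rcases mem_Icc_split hΔ' (43 / 20 : ℝ) with hΔ' | hΔ'
    · rcases mem_Icc_split ha (497 / 400 : ℝ) with ha' | ha'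
      · have h := (hg1212Ax5Sub_0_0 hΔ' ha' hb hc hν).1
        exact ⟨le_trans (by norm_num) h.1, h.2.trans (by norm_num)⟩
      · have h := (hg1212Ax5Sub_0_1 hΔ' ha' hb hc hν).1
        exact ⟨le_trans (by norm_num) h.1, h.2.trans (by norm_num)⟩
    · rcases mem_Icc_split ha (497 / 400 : ℝ) with ha' | ha'
      · have h := (hg1212Ax5Sub_1_0 hΔ' ha' hb hc hν).1
        exact ⟨le_trans (by norm_num) h.1, h.2.trans (by norm_num)⟩
      · have h := (hg1212Ax5Sub_1_1 hΔ' ha' hb hc hν).1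
        exact ⟨le_trans (by norm_num) h.1, h.2.trans (by norm_num)⟩
  · clear hΔ
    rcases mem_Icc_split hΔ' (43 / 20 : ℝ) with hΔ' | hΔ'
    · rcases mem_Icc_split ha (497 / 400 : ℝ) with ha' | ha'
      · have h := (hg1212Ax5Sub_0_0 hΔ' ha' hb hc hν).2
        exact ⟨le_trans (by norm_num) h.1, h.2.trans (by norm_num)⟩
      · have h := (hg1212Ax5Sub_0_1 hΔ' ha' hb hc hν).2
        exact ⟨le_trans (by norm_num) h.1, h.2.trans (by norm_num)⟩
    · rcases mem_Icc_split ha (497 / 400 : ℝ) with ha' | ha'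
      · have h := (hg1212Ax5Sub_1_0 hΔ' ha' hb hc hν).2
        exact ⟨le_trans (by norm_num) h.1, h.2.trans (by norm_num)⟩
      · have h := (hg1212Ax5Sub_1_1 hΔ' ha' hb hc hν).2
        exact ⟨le_trans (by norm_num) h.1, h.2.trans (by norm_num)⟩

/-- **Slab 6, a ∈ [0.5, 0.6] eV**: on the co-shifted box (t_pp + a ∈ [1.144, 1.263], t_pp′ + a ∈ [0.663, 0.787]) at per-spin
filling ∈ [0.4, 0.42]: `ε_F ∈ [0.98, 1.7]` and `t′/t ∈ [-0.4807, -0.4007]` — MEETS vs the E row. [folklore] -/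
theorem hg1212AxSlab6_window {Δ tpd tpp c ε : ℝ} (hΔ : Δ ∈ Set.Icc (37 / 20 : ℝ) (49 / 20 : ℝ))
    (ha : tpd ∈ Set.Icc (241 / 200 : ℝ) (32 / 25 : ℝ)) (hb : tpp ∈ Set.Icc (143 / 125 : ℝ) (1263 / 1000 : ℝ))
    (hc : c ∈ Set.Icc (663 / 1000 : ℝ) (787 / 1000 : ℝ))
    (hν : abFilling Δ tpd tpp c ε ∈ Set.Icc (2 / 5 : ℝ) (21 / 50 : ℝ)) :
    ε ∈ Set.Icc (49 / 50 : ℝ) (17 / 10 : ℝ) ∧ fsRatio Δ tpd tpp c ε ∈ Set.Icc (-(4807 / 10000 : ℝ)) (-(4007 / 10000 : ℝ)) := by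
  have hΔ' := hΔ
  constructor
  · clear hΔ
    rcases mem_Icc_split hΔ' (43 / 20 : ℝ) with hΔ' | hΔ'
    · rcases mem_Icc_split ha (497 / 400 : ℝ) with ha' | ha'
      · have h := (hg1212Ax6Sub_0_0 hΔ' ha' hb hc hν).1
        exact ⟨le_trans (by norm_num) h.1, h.2.trans (by norm_num)⟩
      · have h := (hg1212Ax6Sub_0_1 hΔ' ha' hb hc hν).1
        exact ⟨le_trans (by norm_num) h.1, h.2.trans (by norm_num)⟩
    · rcases mem_Icc_split ha (497 / 400 : ℝ) with ha' | ha'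
      · have h := (hg1212Ax6Sub_1_0 hΔ' ha' hb hc hν).1
        exact ⟨le_trans (by norm_num) h.1, h.2.trans (by norm_num)⟩
      · have h := (hg1212Ax6Sub_1_1 hΔ' ha' hb hc hν).1
        exact ⟨le_trans (by norm_num) h.1, h.2.trans (by norm_num)⟩
  · clear hΔ
    rcases mem_Icc_split hΔ' (43 / 20 : ℝ) with hΔ' | hΔ'
    · rcases mem_Icc_split ha (497 / 400 : ℝ) with ha' | ha'
      · have h := (hg1212Ax6Sub_0_0 hΔ' ha' hb hc hν).2
        exact ⟨le_trans (by norm_num) h.1, h.2.trans (by norm_num)⟩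
      · have h := (hg1212Ax6Sub_0_1 hΔ' ha' hb hc hν).2
        exact ⟨le_trans (by norm_num) h.1, h.2.trans (by norm_num)⟩
    · rcases mem_Icc_split ha (497 / 400 : ℝ) with ha' | ha'
      · have h := (hg1212Ax6Sub_1_0 hΔ' ha' hb hc hν).2
        exact ⟨le_trans (by norm_num) h.1, h.2.trans (by norm_num)⟩
      · have h := (hg1212Ax6Sub_1_1 hΔ' ha' hb hc hν).2
        exact ⟨le_trans (by norm_num) h.1, h.2.trans (by norm_num)⟩

end Summit.Ventures.CertifiedManyBodySolver.Downfold.Emery
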